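import Literature.Barriers.CriticalPhenomena.LaceExpansionFourier
import Mathlib.MeasureTheory.Function.LpSeminorm.CompareExp
import Mathlib.MeasureTheory.Function.LpSeminorm.TriangleInequality
import HarnessLib

/-!
# Finite trigonometric sums with power-law coefficients: `L^q([-π,π]^d)` bounds without
# Hausdorff–Young

Support file (all results proved) for the proof of the named fact
`SpreadOutIsing.LiuSlade2024_thm12_critical` (Liu–Slade 2024, Theorem 1.2, critical case). The
source controls high derivatives `F̂_γ = 𝓕[(ix)^γ F]` of the transform of a function with
`|F(x)| ≤ K⟦x⟧^{-(d+2+ρ)}` in `L^q(𝕋^d)` through its Lemma 2.6 (ii): "if `d/2 < b ≤ d` and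
`|h(x)| ≤ K⟦x⟧^{-b}` then `‖ĥ‖_q ≤ c_{d,b,q} K` for all `1 ≤ q < d/(d - b)`", proved there by the
Hausdorff–Young inequality (and again, with a factor `sin(u x₁)`, in Lemma 2.14 (ii)). Mathlib has
no Hausdorff–Young inequality. This file proves the same bound, in the same range of `q`, for
FINITE trigonometric sums (the setting of the sequel, where `F` is first truncated to finite
support) by an elementary dyadic argument:

* `LS24.trigSum S c θ k = Σ_{x ∈ S} c(x) cos(k·x + θ)` — a finite cosine sum with a common phase
  (all `∂_j^n` and all differences `U_u` of `Σ_x F(x) cos(k·x)` are of this form);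
* `abs_trigSum_le` (`|T| ≤ Σ|c|`), `integral_trigSum_sq_le` (Parseval as an INEQUALITY,
  `∫_{[-π,π]^d} T² ≤ (2π)^d Σ c²`, from the orthogonality `∫ cos(k·z) dk = (2π)^d δ_{z,0}`);
* `lintegral_rpow_le_of_bound_of_sq` — `∫|T|^q ≤ M^{q-2} ∫ T²` for `|T| ≤ M`, `q ≥ 2`;
* the dyadic decomposition `T = Σ_j T_j` over the shells `2^j ≤ ⟦x⟧ < 2^{j+1}` (`shellIndex`),
  the lattice-point count `#{⟦x⟧ < 2^{j+1}} ≤ 5^d 2^{jd}`, and the shell bounds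
  `Σ_{shell j} |c| ≤ 5^d K 2^{j(d-b)}`, `Σ_{shell j} c² ≤ 5^d K² 2^{j(d-2b)}`;
* **`eLpNorm_trigSum_le`** — for `d/2 < b ≤ d`, `2 ≤ q` with `κ = b + d/q - d > 0` (i.e.
  `q < d/(d-b)`): `‖T‖_{L^q([-π,π]^d)} ≤ (2π)^{d/q} 5^d (1 - 2^{-κ})⁻¹ K`, uniformly in the
  (finite) support `S` and the phase; and the trivial companion `abs_trigSum_le_of_decay` for
  `b > d` (`|T| ≤ K Σ_x ⟦x⟧^{-b}`).

## References

* Y. Liu, G. Slade, *Gaussian deconvolution and the lace expansion*, Probab. Theory Related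
  Fields (2024), arXiv:2310.07635: Lemma 2.6 and its proof, Lemma 2.14 and its proof (§2.2.2,
  §2.3.3) [LiuSlade2024].
-/

noncomputable section

namespace Literature.Barriers.CriticalPhenomena.SpreadOutIsing

namespace LS24

open _root_.MeasureTheory _root_.Filter Real Finset Literature.Probability.LatticeModels
open Literature.Probability.Percolation (kdot_add kdot_neg)
open scoped ENNReal NNReal BigOperators

variable {d : ℕ}

/-! ### Phased cosine sums -/

/-- The finite trigonometric sum `T(k) = Σ_{x ∈ S} c(x) cos(k·x + θ)` with a common phase `θ`.
[cite: LiuSlade2024, Lemma 2.6 (the transform ĥ of a lattice function h)] -/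
def trigSum (S : Finset (Site d)) (c : Site d → ℝ) (θ : ℝ) (k : Fin d → ℝ) : ℝ :=
  ∑ x ∈ S, c x * Real.cos (kdot k x + θ)

/-- `T` is continuous. [folklore] -/
theorem continuous_trigSum (S : Finset (Site d)) (c : Site d → ℝ) (θ : ℝ) :
    Continuous (trigSum S c θ) := by
  unfold trigSum kdot
  fun_prop

/-- `T` is measurable. [folklore] -/
theorem measurable_trigSum (S : Finset (Site d)) (c : Site d → ℝ) (θ : ℝ) :
    Measurable (trigSum S c θ) :=
  (continuous_trigSum S c θ).measurable

/-- `T` is `2π`-periodic in every coordinate. [folklore] -/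
theorem trigSum_add_twoPi_mul (S : Finset (Site d)) (c : Site d → ℝ) (θ : ℝ) (k : Fin d → ℝ)
    (n : Fin d → ℤ) : trigSum S c θ (fun j => k j + 2 * π * n j) = trigSum S c θ k := by
  unfold trigSum
  refine sum_congr rfl fun x _ => ?_
  rw [LaceExpansion.kdot_add_twoPi_mul, add_right_comm, Real.cos_add_int_mul_two_pi]

/-- **`|T(k)| ≤ Σ_{x ∈ S} |c(x)|`.** [cite: LiuSlade2024, Lemma 2.6 (i)] -/
theorem abs_trigSum_le (S : Finset (Site d)) (c : Site d → ℝ) (θ : ℝ) (k : Fin d → ℝ) :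
    |trigSum S c θ k| ≤ ∑ x ∈ S, |c x| := by
  unfold trigSum
  refine (abs_sum_le_sum_abs _ _).trans (sum_le_sum fun x _ => ?_)
  rw [abs_mul]
  exact mul_le_of_le_one_right (abs_nonneg _) (abs_cos_le_one _)

/-- Linearity in the coefficients: restricting the support by a filter. [folklore] -/
theorem trigSum_filter (S : Finset (Site d)) (p : Site d → Prop) [DecidablePred p] (c : Site d → ℝ)
    (θ : ℝ) (k : Fin d → ℝ) :
    trigSum (S.filter p) c θ k = ∑ x ∈ S, if p x then c x * Real.cos (kdot k x + θ) else 0 := by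
  unfold trigSum
  rw [sum_filter]

/-! ### Parseval as an inequality -/

/-- `∫_{[-π,π]^d} sin(k·z) dk = 0` (oddness under `k ↦ -k`). [folklore] -/
theorem integral_sin_kdot (z : Site d) : ∫ k in cube d, Real.sin (kdot k z) = 0 := by
  have hsymm : ∫ k in cube d, Real.sin (kdot k z) = ∫ k in cube d, Real.sin (kdot (-k) z) := by
    have hneg : (fun k : Fin d → ℝ => -k) ⁻¹' cube d = cube d := by
      ext k; simp only [Set.mem_preimage, cube, Set.mem_pi, Set.mem_univ, true_implies,
        Pi.neg_apply, Set.mem_Icc]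
      constructor <;> intro h i <;> constructor <;> linarith [(h i).1, (h i).2]
    have hmp : MeasurePreserving (fun k : Fin d → ℝ => -k) volume volume :=
      Measure.measurePreserving_neg volume
    rw [← hmp.setIntegral_preimage_emb (MeasurableEquiv.neg (Fin d → ℝ)).measurableEmbedding
      (fun k => Real.sin (kdot k z)) (cube d), hneg]
  have h2 : ∫ k in cube d, Real.sin (kdot (-k) z) = -∫ k in cube d, Real.sin (kdot k z) := by
    rw [← integral_neg]
    refine integral_congr_ae (ae_of_all _ fun k => ?_)
    show Real.sin (kdot (-k) z) = -Real.sin (kdot k z)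
    rw [LaceExpansion.neg_kdot, Real.sin_neg]
  linarith

/-- `∫_{[-π,π]^d} cos(k·z + φ) dk = (2π)^d cos φ · δ_{z,0}`. [folklore] -/
theorem integral_cos_kdot_add (z : Site d) (φ : ℝ) :
    ∫ k in cube d, Real.cos (kdot k z + φ) = if z = 0 then (2 * π) ^ d * Real.cos φ else 0 := by
  have hc : Integrable (fun k : Fin d → ℝ => Real.cos (kdot k z)) (volume.restrict (cube d)) := by
    rw [LaceExpansion.volume_restrict_cube_eq]
    exact LaceExpansion.integrable_of_norm_le (by unfold kdot; fun_prop) (C := 1) fun k => by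
      simpa using abs_cos_le_one (kdot k z)
  have hs : Integrable (fun k : Fin d → ℝ => Real.sin (kdot k z)) (volume.restrict (cube d)) := by
    rw [LaceExpansion.volume_restrict_cube_eq]
    exact LaceExpansion.integrable_of_norm_le (by unfold kdot; fun_prop) (C := 1) fun k => by
      simpa using abs_sin_le_one (kdot k z)
  simp_rw [Real.cos_add]
  rw [integral_sub (hc.mul_const _) (hs.mul_const _), integral_mul_const, integral_mul_const,
    LaceExpansion.integral_cos_kdot, integral_sin_kdot]
  split_ifs <;> ring

/-- **Parseval as an inequality**: `∫_{[-π,π]^d} T(k)² dk ≤ (2π)^d Σ_{x ∈ S} c(x)²`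
(writing `T = cos θ · Σ c cos(k·x) - sin θ · Σ c sin(k·x)`, `T² ≤ C² + S²`, and
`∫ (C² + S²) = Σ_{x,y} c(x)c(y) ∫ cos(k·(x-y)) = (2π)^d Σ c²`). This is the `L²` input
"`b > d/2` ensures `h ∈ ℓ²`, so that we can use the `L²` Fourier transform" of the source's
Lemma 2.6 (ii), for finite sums. [cite: LiuSlade2024, proof of Lemma 2.6 (ii)] -/
theorem integral_trigSum_sq_le (S : Finset (Site d)) (c : Site d → ℝ) (θ : ℝ) :
    ∫ k in cube d, trigSum S c θ k ^ 2 ≤ (2 * π) ^ d * ∑ x ∈ S, c x ^ 2 := by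
  -- the cosine and sine sums
  set Cs : (Fin d → ℝ) → ℝ := fun k => ∑ x ∈ S, c x * Real.cos (kdot k x) with hCs
  set Ss : (Fin d → ℝ) → ℝ := fun k => ∑ x ∈ S, c x * Real.sin (kdot k x) with hSs
  have hT : ∀ k, trigSum S c θ k = Real.cos θ * Cs k - Real.sin θ * Ss k := by
    intro k
    simp only [trigSum, hCs, hSs, mul_sum]
    rw [← sum_sub_distrib]
    refine sum_congr rfl fun x _ => ?_
    rw [Real.cos_add]; ring
  have hpt : ∀ k, trigSum S c θ k ^ 2 ≤ Cs k ^ 2 + Ss k ^ 2 := by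
    intro k
    rw [hT]
    nlinarith [Real.cos_sq_add_sin_sq θ, sq_nonneg (Real.sin θ * Cs k + Real.cos θ * Ss k)]
  -- `Cs² + Ss² = Σ_{x,y} c_x c_y cos(k·(x-y))`
  have hexp : ∀ k, Cs k ^ 2 + Ss k ^ 2 = ∑ x ∈ S, ∑ y ∈ S, c x * c y * Real.cos (kdot k (x - y)) := by
    intro k
    simp only [hCs, hSs, sq, sum_mul, mul_sum, ← sum_add_distrib]
    refine sum_congr rfl fun x _ => sum_congr rfl fun y _ => ?_
    rw [sub_eq_add_neg, kdot_add, kdot_neg, Real.cos_add, Real.cos_neg, Real.sin_neg]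
    ring
  have hint1 : ∀ v : Site d, Integrable (fun k : Fin d → ℝ => Real.cos (kdot k v))
      (volume.restrict (cube d)) := fun v => by
    rw [LaceExpansion.volume_restrict_cube_eq]
    exact LaceExpansion.integrable_of_norm_le (by unfold kdot; fun_prop) (C := 1) fun k => by
      simpa using abs_cos_le_one (kdot k v)
  have hmeasT : AEStronglyMeasurable (fun k => trigSum S c θ k ^ 2) (volume.restrict (cube d)) :=
    ((continuous_trigSum S c θ).pow 2).aestronglyMeasurable
  have hintR : Integrable (fun k => Cs k ^ 2 + Ss k ^ 2) (volume.restrict (cube d)) := by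
    simp_rw [hexp]
    exact integrable_finsetSum _ fun x _ => integrable_finsetSum _ fun y _ =>
      (hint1 _).const_mul _
  calc ∫ k in cube d, trigSum S c θ k ^ 2 ≤ ∫ k in cube d, (Cs k ^ 2 + Ss k ^ 2) :=
        integral_mono_of_nonneg (ae_of_all _ fun k => sq_nonneg _) hintR (ae_of_all _ hpt)
    _ = ∑ x ∈ S, ∑ y ∈ S, c x * c y * ∫ k in cube d, Real.cos (kdot k (x - y)) := by
        simp_rw [hexp]
        rw [integral_finsetSum _ fun x _ => integrable_finsetSum _ fun y _ => (hint1 _).const_mul _]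
        refine sum_congr rfl fun x _ => ?_
        rw [integral_finsetSum _ fun y _ => (hint1 _).const_mul _]
        refine sum_congr rfl fun y _ => ?_
        rw [integral_const_mul]
    _ = ∑ x ∈ S, c x * c x * (2 * π) ^ d := by
        refine sum_congr rfl fun x hx => ?_
        rw [sum_eq_single x]
        · rw [sub_self, LaceExpansion.integral_cos_kdot, if_pos rfl]
        · intro y _ hyx
          rw [LaceExpansion.integral_cos_kdot, if_neg (sub_ne_zero.2 (Ne.symm hyx)), mul_zero]
        · intro h; exact absurd hx h
    _ = (2 * π) ^ d * ∑ x ∈ S, c x ^ 2 := by rw [mul_sum]; refine sum_congr rfl fun x _ => ?_; ring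

/-! ### From a sup bound and an `L²` bound to `L^q`, `q ≥ 2` -/

/-- `∫⁻ |g|^q ≤ M^{q-2} ∫⁻ |g|²` on the cube when `|g| ≤ M` there and `q ≥ 2` (the pointwise
inequality `|g|^q = |g|^{q-2}|g|² ≤ M^{q-2}|g|²`; this is how the interpolation between `L²`
and `L^∞` is done here without interpolation theory). [folklore] -/
theorem lintegral_rpow_le_of_bound_of_sq {g : (Fin d → ℝ) → ℝ} {M q : ℝ} (hM : 0 ≤ M)
    (hq : 2 ≤ q) (hle : ∀ k ∈ cube d, |g k| ≤ M) :
    ∫⁻ k in cube d, (‖g k‖ₑ : ℝ≥0∞) ^ q ≤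
      ENNReal.ofReal (M ^ (q - 2)) * ∫⁻ k in cube d, (‖g k‖ₑ : ℝ≥0∞) ^ (2 : ℝ) := by
  rw [← lintegral_const_mul' _ _ ENNReal.ofReal_ne_top]
  refine setLIntegral_mono' (measurableSet_cube d) fun k hk => ?_
  have hgk : 0 ≤ |g k| := abs_nonneg _
  rw [Real.enorm_eq_ofReal_abs, ENNReal.ofReal_rpow_of_nonneg hgk (by linarith),
    ENNReal.ofReal_rpow_of_nonneg hgk (by norm_num), ← ENNReal.ofReal_mul (by positivity)]
  refine ENNReal.ofReal_le_ofReal ?_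
  have hsplit : |g k| ^ q = |g k| ^ (q - 2) * |g k| ^ (2 : ℝ) := by
    rw [← Real.rpow_add' hgk (by linarith)]; ring_nf
  rw [hsplit]
  exact mul_le_mul_of_nonneg_right (Real.rpow_le_rpow hgk (hle k hk) (by linarith))
    (by positivity)

/-- `∫⁻_{cube} |g|² = ofReal (∫_{cube} g²)` for a continuous `g`. [folklore] -/
theorem lintegral_sq_eq_ofReal_integral_sq {g : (Fin d → ℝ) → ℝ} (hg : Continuous g) :
    ∫⁻ k in cube d, (‖g k‖ₑ : ℝ≥0∞) ^ (2 : ℝ) = ENNReal.ofReal (∫ k in cube d, g k ^ 2) := by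
  have hint : IntegrableOn (fun k => g k ^ 2) (cube d) :=
    ((hg.pow 2).continuousOn).integrableOn_compact (isCompact_univ_pi fun (_ : Fin d) => isCompact_Icc)
  rw [ofReal_integral_eq_lintegral_ofReal hint (ae_of_all _ fun k => sq_nonneg (g k))]
  refine lintegral_congr fun k => ?_
  rw [Real.enorm_eq_ofReal_abs, ENNReal.ofReal_rpow_of_nonneg (abs_nonneg _) (by norm_num)]
  congr 1
  rw [Real.rpow_two, sq_abs]

/-- **`L^q` from sup and `L²`**: if `|g| ≤ M` on the cube, `∫_{cube} g² ≤ V` and `q ≥ 2`, then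
`‖g‖_{L^q([-π,π]^d)} ≤ (M^{q-2} V)^{1/q}` (`g` continuous, `M, V ≥ 0`). [folklore] -/
theorem eLpNorm_le_of_bound_of_integral_sq_le {g : (Fin d → ℝ) → ℝ} (hg : Continuous g)
    {M V q : ℝ} (hM : 0 ≤ M) (hV : 0 ≤ V) (hq : 2 ≤ q) (hle : ∀ k ∈ cube d, |g k| ≤ M)
    (hsq : ∫ k in cube d, g k ^ 2 ≤ V) :
    eLpNorm g (ENNReal.ofReal q) (volume.restrict (cube d)) ≤
      ENNReal.ofReal ((M ^ (q - 2) * V) ^ (1 / q)) := by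
  have hq0 : 0 < q := by linarith
  have hqne : ENNReal.ofReal q ≠ 0 := by simpa using hq0
  rw [eLpNorm_eq_lintegral_rpow_enorm_toReal hqne ENNReal.ofReal_ne_top, ENNReal.toReal_ofReal hq0.le,
    ← ENNReal.ofReal_rpow_of_nonneg (by positivity) (by positivity)]
  gcongr
  calc ∫⁻ k, (‖g k‖ₑ : ℝ≥0∞) ^ q ∂volume.restrict (cube d)
      ≤ ENNReal.ofReal (M ^ (q - 2)) * ∫⁻ k in cube d, (‖g k‖ₑ : ℝ≥0∞) ^ (2 : ℝ) :=
        lintegral_rpow_le_of_bound_of_sq hM hq hle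
    _ = ENNReal.ofReal (M ^ (q - 2)) * ENNReal.ofReal (∫ k in cube d, g k ^ 2) := by
        rw [lintegral_sq_eq_ofReal_integral_sq hg]
    _ ≤ ENNReal.ofReal (M ^ (q - 2)) * ENNReal.ofReal V := by gcongr
    _ = ENNReal.ofReal (M ^ (q - 2) * V) := (ENNReal.ofReal_mul (by positivity)).symm

/-! ### Dyadic shells and lattice-point counting -/

/-- The dyadic shell index of a lattice point: `2^j ≤ ⟦x⟧ < 2^{j+1}` for `j = shellIndex x`.
[cite: LiuSlade2024, proof of Lemma 2.6 (ii)] -/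
def shellIndex (x : Site d) : ℕ := Nat.log 2 ⌊jnorm x⌋₊

/-- `2^{shellIndex x} ≤ ⟦x⟧`. [folklore] -/
theorem two_pow_shellIndex_le (x : Site d) : (2 : ℝ) ^ shellIndex x ≤ jnorm x := by
  have h1 : 1 ≤ ⌊jnorm x⌋₊ := Nat.one_le_floor_iff _ |>.2 (one_le_jnorm x)
  have h2 : (2 : ℕ) ^ Nat.log 2 ⌊jnorm x⌋₊ ≤ ⌊jnorm x⌋₊ := Nat.pow_log_le_self 2 (by omega)
  calc (2 : ℝ) ^ shellIndex x = ((2 : ℕ) ^ Nat.log 2 ⌊jnorm x⌋₊ : ℕ) := by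
        rw [shellIndex]; push_cast; ring
    _ ≤ (⌊jnorm x⌋₊ : ℝ) := by exact_mod_cast h2
    _ ≤ jnorm x := Nat.floor_le (jnorm_pos x).le

/-- `⟦x⟧ < 2^{shellIndex x + 1}`. [folklore] -/
theorem jnorm_lt_two_pow_shellIndex_succ (x : Site d) : jnorm x < (2 : ℝ) ^ (shellIndex x + 1) := by
  have h2 : ⌊jnorm x⌋₊ < (2 : ℕ) ^ (Nat.log 2 ⌊jnorm x⌋₊ + 1) := Nat.lt_pow_succ_log_self (by norm_num) _
  have h3 : ⌊jnorm x⌋₊ + 1 ≤ (2 : ℕ) ^ (Nat.log 2 ⌊jnorm x⌋₊ + 1) := h2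
  calc jnorm x < (⌊jnorm x⌋₊ : ℝ) + 1 := Nat.lt_floor_add_one _
    _ = ((⌊jnorm x⌋₊ + 1 : ℕ) : ℝ) := by push_cast; ring
    _ ≤ (((2 : ℕ) ^ (Nat.log 2 ⌊jnorm x⌋₊ + 1) : ℕ) : ℝ) := by exact_mod_cast h3
    _ = (2 : ℝ) ^ (shellIndex x + 1) := by rw [shellIndex]; push_cast; ring

/-- **Lattice-point count**: the points of `S` with `⟦x⟧ < N` (`N ≥ 1` an integer) number at most
`(2N+1)^d` (they lie in the box `[-N, N]^d`). [folklore] -/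
theorem card_filter_jnorm_lt_le (S : Finset (Site d)) (N : ℕ) :
    (S.filter fun x => jnorm x < N).card ≤ (2 * N + 1) ^ d := by
  classical
  have hsub : (S.filter fun x => jnorm x < N) ⊆
      Fintype.piFinset fun _ : Fin d => Finset.Icc (-(N : ℤ)) N := by
    intro x hx
    rw [Finset.mem_filter] at hx
    rw [Fintype.mem_piFinset]
    intro i
    rw [Finset.mem_Icc, ← abs_le]
    have h1 : |((x i : ℤ) : ℝ)| ≤ jnorm x := (abs_apply_le_euclidNorm x i).trans (euclidNorm_le_jnorm x)
    have h2 : |((x i : ℤ) : ℝ)| < N := lt_of_le_of_lt h1 hx.2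
    have h3 : ((|x i| : ℤ) : ℝ) < N := by rw [Int.cast_abs]; exact h2
    exact_mod_cast h3.le
  refine (Finset.card_le_card hsub).trans (le_of_eq ?_)
  rw [Fintype.card_piFinset, Finset.prod_const, Finset.card_univ, Fintype.card_fin, Int.card_Icc]
  congr 1
  omega

/-- The shell `j` of `S` has at most `5^d 2^{jd}` points. [folklore] -/
theorem card_shell_le (S : Finset (Site d)) (j : ℕ) :
    ((S.filter fun x => shellIndex x = j).card : ℝ) ≤ 5 ^ d * (2 : ℝ) ^ (j * d) := by
  classical
  have hsub : (S.filter fun x => shellIndex x = j) ⊆ S.filter fun x => jnorm x < (2 ^ (j + 1) : ℕ) := by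
    intro x hx
    rw [Finset.mem_filter] at hx ⊢
    refine ⟨hx.1, ?_⟩
    have := jnorm_lt_two_pow_shellIndex_succ x
    rw [hx.2] at this
    exact_mod_cast this
  have h1 := (Finset.card_le_card hsub).trans (card_filter_jnorm_lt_le S (2 ^ (j + 1)))
  calc ((S.filter fun x => shellIndex x = j).card : ℝ) ≤ ((2 * 2 ^ (j + 1) + 1) ^ d : ℕ) := by
        exact_mod_cast h1
    _ ≤ ((5 * 2 ^ j) ^ d : ℕ) := by
        have h2 : 2 * (2 ^ j * 2) + 1 ≤ 5 * 2 ^ j := by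
          have h1 : 1 ≤ 2 ^ j := Nat.one_le_two_pow
          generalize 2 ^ j = m at h1 ⊢
          omega
        exact_mod_cast Nat.pow_le_pow_left (by rw [pow_succ]; exact h2) d
    _ = 5 ^ d * (2 : ℝ) ^ (j * d) := by push_cast; rw [mul_pow, ← pow_mul]

/-! ### Shell-wise coefficient bounds -/

/-- On the shell `j`, `⟦x⟧^{-b} ≤ 2^{-jb}` (`b ≥ 0`). [folklore] -/
theorem jnorm_rpow_neg_le_of_shell {x : Site d} {j : ℕ} (hx : shellIndex x = j) {b : ℝ} (hb : 0 ≤ b) :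
    jnorm x ^ (-b) ≤ ((2 : ℝ) ^ (j : ℝ)) ^ (-b) := by
  have h1 : (2 : ℝ) ^ (j : ℝ) ≤ jnorm x := by
    rw [Real.rpow_natCast, ← hx]; exact two_pow_shellIndex_le x
  exact Real.rpow_le_rpow_of_nonpos (by positivity) h1 (by linarith)

/-- `Σ_{shell j} |c| ≤ 5^d K 2^{jd} 2^{-jb}` under `|c(x)| ≤ K⟦x⟧^{-b}` (`b ≥ 0`).
[cite: LiuSlade2024, proof of Lemma 2.6 (ii)] -/
theorem sum_shell_abs_le (S : Finset (Site d)) {c : Site d → ℝ} {K b : ℝ} (hK : 0 ≤ K) (hb : 0 ≤ b)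
    (hc : ∀ x ∈ S, |c x| ≤ K * jnorm x ^ (-b)) (j : ℕ) :
    ∑ x ∈ S.filter (fun x => shellIndex x = j), |c x| ≤
      5 ^ d * (2 : ℝ) ^ (j * d) * (K * ((2 : ℝ) ^ (j : ℝ)) ^ (-b)) := by
  classical
  calc ∑ x ∈ S.filter (fun x => shellIndex x = j), |c x|
      ≤ ∑ x ∈ S.filter (fun x => shellIndex x = j), K * ((2 : ℝ) ^ (j : ℝ)) ^ (-b) := by
        refine sum_le_sum fun x hx => ?_
        rw [Finset.mem_filter] at hx
        exact (hc x hx.1).trans (mul_le_mul_of_nonneg_left (jnorm_rpow_neg_le_of_shell hx.2 hb) hK)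
    _ = (S.filter (fun x => shellIndex x = j)).card * (K * ((2 : ℝ) ^ (j : ℝ)) ^ (-b)) := by
        rw [sum_const, nsmul_eq_mul]
    _ ≤ 5 ^ d * (2 : ℝ) ^ (j * d) * (K * ((2 : ℝ) ^ (j : ℝ)) ^ (-b)) :=
        mul_le_mul_of_nonneg_right (card_shell_le S j) (by positivity)

/-- `Σ_{shell j} c² ≤ 5^d 2^{jd} (K 2^{-jb})²` under `|c(x)| ≤ K⟦x⟧^{-b}` (`b ≥ 0`).
[cite: LiuSlade2024, proof of Lemma 2.6 (ii)] -/
theorem sum_shell_sq_le (S : Finset (Site d)) {c : Site d → ℝ} {K b : ℝ} (hK : 0 ≤ K) (hb : 0 ≤ b)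
    (hc : ∀ x ∈ S, |c x| ≤ K * jnorm x ^ (-b)) (j : ℕ) :
    ∑ x ∈ S.filter (fun x => shellIndex x = j), c x ^ 2 ≤
      5 ^ d * (2 : ℝ) ^ (j * d) * (K * ((2 : ℝ) ^ (j : ℝ)) ^ (-b)) ^ 2 := by
  classical
  calc ∑ x ∈ S.filter (fun x => shellIndex x = j), c x ^ 2
      ≤ ∑ x ∈ S.filter (fun x => shellIndex x = j), (K * ((2 : ℝ) ^ (j : ℝ)) ^ (-b)) ^ 2 := by
        refine sum_le_sum fun x hx => ?_
        rw [Finset.mem_filter] at hx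
        rw [← sq_abs]
        have h := (hc x hx.1).trans (mul_le_mul_of_nonneg_left (jnorm_rpow_neg_le_of_shell hx.2 hb) hK)
        exact pow_le_pow_left₀ (abs_nonneg _) h 2
    _ = (S.filter (fun x => shellIndex x = j)).card * (K * ((2 : ℝ) ^ (j : ℝ)) ^ (-b)) ^ 2 := by
        rw [sum_const, nsmul_eq_mul]
    _ ≤ 5 ^ d * (2 : ℝ) ^ (j * d) * (K * ((2 : ℝ) ^ (j : ℝ)) ^ (-b)) ^ 2 :=
        mul_le_mul_of_nonneg_right (card_shell_le S j) (by positivity)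

/-- The exponent algebra of the dyadic argument: with `X = 2^j`, `M = 5^d X^d K X^{-b}`,
`V = (2π)^d 5^d X^d (K X^{-b})²` and `κ = b + d/q - d`,
`M^{q-2} V = 5^{-d} ((2π)^{d/q} 5^d K X^{-κ})^q ≤ ((2π)^{d/q} 5^d K X^{-κ})^q`. [folklore] -/
theorem shell_algebra (d : ℕ) {K b q X : ℝ} (hK : 0 ≤ K) (hq : 2 ≤ q) (hX : 0 < X) :
    (5 ^ d * X ^ (d : ℝ) * (K * X ^ (-b))) ^ (q - 2) * ((2 * π) ^ d * (5 ^ d * X ^ (d : ℝ) * (K * X ^ (-b)) ^ 2))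
      ≤ ((2 * π) ^ ((d : ℝ) / q) * 5 ^ d * K * X ^ (-(b + d / q - d))) ^ q := by
  have hq0 : 0 < q := by linarith
  have h5 : (0 : ℝ) < 5 ^ d := by positivity
  have h2π : (0 : ℝ) < 2 * π := by positivity
  -- rewrite everything as products of real powers
  have hXd : X ^ (d : ℝ) * X ^ (-b) = X ^ ((d : ℝ) - b) := by
    rw [← Real.rpow_add hX]; ring_nf
  have hL : (5 ^ d * X ^ (d : ℝ) * (K * X ^ (-b))) ^ (q - 2) *
      ((2 * π) ^ d * (5 ^ d * X ^ (d : ℝ) * (K * X ^ (-b)) ^ 2)) =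
      (2 * π) ^ d * (5 ^ d : ℝ) ^ (q - 1) * (K ^ (q - 2) * K ^ 2) *
        (X ^ (((d : ℝ) - b) * (q - 2)) * X ^ ((d : ℝ) - 2 * b)) := by
    have e1 : 5 ^ d * X ^ (d : ℝ) * (K * X ^ (-b)) = (5 ^ d : ℝ) * K * X ^ ((d : ℝ) - b) := by
      rw [← hXd]; ring
    have e2 : 5 ^ d * X ^ (d : ℝ) * (K * X ^ (-b)) ^ 2 = (5 ^ d : ℝ) * K ^ 2 * X ^ ((d : ℝ) - 2 * b) := by
      have : X ^ ((d : ℝ) - 2 * b) = X ^ (d : ℝ) * (X ^ (-b)) ^ 2 := by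
        rw [← Real.rpow_natCast (X ^ (-b)) 2, ← Real.rpow_mul hX.le, ← Real.rpow_add hX]
        push_cast; ring_nf
      rw [this]; ring
    rw [e1, e2, Real.mul_rpow (by positivity) (Real.rpow_nonneg hX.le _),
      Real.mul_rpow h5.le hK, ← Real.rpow_mul hX.le]
    have e3 : (5 ^ d : ℝ) ^ (q - 1) = (5 ^ d : ℝ) ^ (q - 2) * 5 ^ d := by
      rw [show q - 1 = (q - 2) + 1 by ring, Real.rpow_add h5, Real.rpow_one]
    rw [e3]; ring
  have hR : ((2 * π) ^ ((d : ℝ) / q) * 5 ^ d * K * X ^ (-(b + d / q - d))) ^ q =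
      (2 * π) ^ d * (5 ^ d : ℝ) ^ q * K ^ q * X ^ (-(b + d / q - d) * q) := by
    rw [Real.mul_rpow (by positivity) (Real.rpow_nonneg hX.le _),
      Real.mul_rpow (by positivity) hK, Real.mul_rpow (by positivity) h5.le,
      ← Real.rpow_mul h2π.le, ← Real.rpow_mul hX.le, div_mul_cancel₀ _ hq0.ne', Real.rpow_natCast]
  rw [hL, hR]
  -- compare factor by factor
  have hKq : K ^ (q - 2) * K ^ 2 = K ^ q := by
    rw [← Real.rpow_natCast K 2, ← Real.rpow_add' hK (by push_cast; linarith)]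
    push_cast; ring_nf
  have hXq : X ^ (((d : ℝ) - b) * (q - 2)) * X ^ ((d : ℝ) - 2 * b) = X ^ (-(b + d / q - d) * q) := by
    rw [← Real.rpow_add hX]
    congr 1
    field_simp
    ring
  have h5q : (5 ^ d : ℝ) ^ (q - 1) ≤ (5 ^ d : ℝ) ^ q :=
    Real.rpow_le_rpow_of_exponent_le (one_le_pow₀ (by norm_num)) (by linarith)
  rw [hKq, hXq]
  have hrest : 0 ≤ (2 * π) ^ d * (K ^ q * X ^ (-(b + d / q - d) * q)) := by positivity
  calc (2 * π) ^ d * (5 ^ d : ℝ) ^ (q - 1) * K ^ q * X ^ (-(b + d / q - d) * q)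
      = (5 ^ d : ℝ) ^ (q - 1) * ((2 * π) ^ d * (K ^ q * X ^ (-(b + d / q - d) * q))) := by ring
    _ ≤ (5 ^ d : ℝ) ^ q * ((2 * π) ^ d * (K ^ q * X ^ (-(b + d / q - d) * q))) :=
        mul_le_mul_of_nonneg_right h5q hrest
    _ = (2 * π) ^ d * (5 ^ d : ℝ) ^ q * K ^ q * X ^ (-(b + d / q - d) * q) := by ring

/-! ### The dyadic `L^q` bound -/

/-- **`L^q` bound for one shell**: `‖T_j‖_q ≤ (2π)^{d/q} 5^d K 2^{-jκ}`, `κ = b + d/q - d`.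
[cite: LiuSlade2024, proof of Lemma 2.6 (ii)] -/
theorem eLpNorm_trigSum_shell_le (S : Finset (Site d)) {c : Site d → ℝ} {K b q : ℝ} (hK : 0 ≤ K)
    (hb : 0 ≤ b) (hq : 2 ≤ q) (hc : ∀ x ∈ S, |c x| ≤ K * jnorm x ^ (-b)) (θ : ℝ) (j : ℕ) :
    eLpNorm (trigSum (S.filter fun x => shellIndex x = j) c θ) (ENNReal.ofReal q)
        (volume.restrict (cube d)) ≤
      ENNReal.ofReal ((2 * π) ^ ((d : ℝ) / q) * 5 ^ d * K * ((2 : ℝ) ^ (j : ℝ)) ^ (-(b + d / q - d))) := by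
  classical
  have hq0 : 0 < q := by linarith
  set X : ℝ := (2 : ℝ) ^ (j : ℝ) with hXdef
  have hX : 0 < X := by positivity
  have hXd : (2 : ℝ) ^ (j * d) = X ^ (d : ℝ) := by
    rw [hXdef, ← Real.rpow_natCast, ← Real.rpow_mul (by norm_num)]; push_cast; ring_nf
  set M : ℝ := 5 ^ d * X ^ (d : ℝ) * (K * X ^ (-b)) with hM
  set V : ℝ := (2 * π) ^ d * (5 ^ d * X ^ (d : ℝ) * (K * X ^ (-b)) ^ 2) with hV
  have hMnn : 0 ≤ M := by positivity
  have hVnn : 0 ≤ V := by positivity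
  have hle : ∀ k ∈ cube d, |trigSum (S.filter fun x => shellIndex x = j) c θ k| ≤ M := by
    intro k _
    refine (abs_trigSum_le _ c θ k).trans ?_
    rw [hM, ← hXd]
    exact sum_shell_abs_le S hK hb hc j
  have hsq : ∫ k in cube d, trigSum (S.filter fun x => shellIndex x = j) c θ k ^ 2 ≤ V := by
    refine (integral_trigSum_sq_le _ c θ).trans ?_
    rw [hV, ← hXd]
    exact mul_le_mul_of_nonneg_left (sum_shell_sq_le S hK hb hc j) (by positivity)
  refine (eLpNorm_le_of_bound_of_integral_sq_le (continuous_trigSum _ c θ) hMnn hVnn hq hle hsq).trans ?_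
  refine ENNReal.ofReal_le_ofReal ?_
  have halg := shell_algebra d (b := b) hK hq hX
  have hA : 0 ≤ (2 * π) ^ ((d : ℝ) / q) * 5 ^ d * K * X ^ (-(b + d / q - d)) := by positivity
  calc (M ^ (q - 2) * V) ^ (1 / q)
      ≤ (((2 * π) ^ ((d : ℝ) / q) * 5 ^ d * K * X ^ (-(b + d / q - d))) ^ q) ^ (1 / q) :=
        Real.rpow_le_rpow (by positivity) halg (by positivity)
    _ = (2 * π) ^ ((d : ℝ) / q) * 5 ^ d * K * X ^ (-(b + d / q - d)) := by
        rw [one_div, Real.rpow_rpow_inv hA hq0.ne']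

/-- **Lemma 2.6 (ii) / 2.14 (ii) of Liu–Slade for finite sums, without Hausdorff–Young.** If
`|c(x)| ≤ K⟦x⟧^{-b}` on `S` with `b ≥ 0`, and `q ≥ 2` satisfies `κ := b + d/q - d > 0` (for
`d/2 < b < d` this is the range `2 ≤ q < d/(d - b)` of the source; for `b ≥ d` every `q ≥ 2`),
then `‖Σ_{x ∈ S} c(x) cos(k·x + θ)‖_{L^q([-π,π]^d)} ≤ (2π)^{d/q} 5^d (1 - 2^{-κ})⁻¹ K`,
uniformly in the finite set `S` and the phase `θ` (dyadic shells, `‖T‖_q ≤ Σ_j ‖T_j‖_q`, and the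
geometric series `Σ_j 2^{-jκ}`). [cite: LiuSlade2024, Lemma 2.6 (ii) and Lemma 2.14 (ii)] -/
theorem eLpNorm_trigSum_le (S : Finset (Site d)) {c : Site d → ℝ} {K b q : ℝ} (hK : 0 ≤ K)
    (hb : 0 ≤ b) (hq : 2 ≤ q) (hκ : 0 < b + d / q - d) (hc : ∀ x ∈ S, |c x| ≤ K * jnorm x ^ (-b))
    (θ : ℝ) :
    eLpNorm (trigSum S c θ) (ENNReal.ofReal q) (volume.restrict (cube d)) ≤
      ENNReal.ofReal ((2 * π) ^ ((d : ℝ) / q) * 5 ^ d * (1 - (2 : ℝ) ^ (-(b + d / q - d)))⁻¹ * K) := by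
  classical
  set κ : ℝ := b + d / q - d with hκdef
  set A : ℝ := (2 * π) ^ ((d : ℝ) / q) * 5 ^ d * K with hA
  have hAnn : 0 ≤ A := by positivity
  set r : ℝ := (2 : ℝ) ^ (-κ) with hr
  have hr0 : 0 ≤ r := by positivity
  have hr1 : r < 1 := Real.rpow_lt_one_of_one_lt_of_neg (by norm_num) (by linarith)
  -- dyadic decomposition
  set J : ℕ := S.sup shellIndex with hJ
  set T : ℕ → (Fin d → ℝ) → ℝ := fun j => trigSum (S.filter fun x => shellIndex x = j) c θ with hT
  have hdec : trigSum S c θ = ∑ j ∈ range (J + 1), T j := by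
    funext k
    rw [Finset.sum_apply]
    simp only [hT, trigSum]
    rw [Finset.sum_fiberwise_of_maps_to]
    intro x hx
    exact Finset.mem_range.2 (Nat.lt_succ_of_le (Finset.le_sup hx))
  have hq1 : (1 : ℝ≥0∞) ≤ ENNReal.ofReal q := by
    rw [← ENNReal.ofReal_one]; exact ENNReal.ofReal_le_ofReal (by linarith)
  -- shell bounds and summation
  have hshell : ∀ j ∈ range (J + 1), eLpNorm (T j) (ENNReal.ofReal q) (volume.restrict (cube d)) ≤
      ENNReal.ofReal (A * r ^ j) := by
    intro j _
    refine (eLpNorm_trigSum_shell_le S hK hb hq hc θ j).trans (le_of_eq ?_)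
    congr 1
    rw [hA, hr, ← Real.rpow_natCast ((2 : ℝ) ^ (-κ)) j, ← Real.rpow_mul (by norm_num),
      ← Real.rpow_mul (by norm_num), hκdef]
    ring_nf
  have hgeom : ∑ j ∈ range (J + 1), A * r ^ j ≤ A * (1 - r)⁻¹ := by
    rw [← mul_sum]
    refine mul_le_mul_of_nonneg_left ?_ hAnn
    exact ((summable_geometric_of_lt_one hr0 hr1).sum_le_tsum _ (fun j _ => pow_nonneg hr0 j)).trans
      (le_of_eq (by rw [tsum_geometric_of_lt_one hr0 hr1]))
  calc eLpNorm (trigSum S c θ) (ENNReal.ofReal q) (volume.restrict (cube d))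
      = eLpNorm (∑ j ∈ range (J + 1), T j) (ENNReal.ofReal q) (volume.restrict (cube d)) := by rw [hdec]
    _ ≤ ∑ j ∈ range (J + 1), eLpNorm (T j) (ENNReal.ofReal q) (volume.restrict (cube d)) :=
        eLpNorm_sum_le (fun j _ => (continuous_trigSum _ c θ).aestronglyMeasurable) hq1
    _ ≤ ∑ j ∈ range (J + 1), ENNReal.ofReal (A * r ^ j) := sum_le_sum hshell
    _ = ENNReal.ofReal (∑ j ∈ range (J + 1), A * r ^ j) :=
        (ENNReal.ofReal_sum_of_nonneg fun j _ => by positivity).symm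
    _ ≤ ENNReal.ofReal (A * (1 - r)⁻¹) := ENNReal.ofReal_le_ofReal hgeom
    _ = ENNReal.ofReal ((2 * π) ^ ((d : ℝ) / q) * 5 ^ d * (1 - (2 : ℝ) ^ (-(b + d / q - d)))⁻¹ * K) := by
        rw [hA, hr, hκdef]; ring_nf

/-- The trivial companion for summable coefficients: if `|c(x)| ≤ K⟦x⟧^{-b}` with `b > d` then
`|T(k)| ≤ K Σ_{x ∈ ℤ^d} ⟦x⟧^{-b}` for all `k`. [cite: LiuSlade2024, Lemma 2.6 (i)] -/
theorem abs_trigSum_le_of_decay (S : Finset (Site d)) {c : Site d → ℝ} {K b : ℝ} (hK : 0 ≤ K)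
    (hb : (d : ℝ) < b) (hc : ∀ x ∈ S, |c x| ≤ K * jnorm x ^ (-b)) (θ : ℝ) (k : Fin d → ℝ) :
    |trigSum S c θ k| ≤ K * ∑' x : Site d, jnorm x ^ (-b) := by
  refine (abs_trigSum_le S c θ k).trans ?_
  calc ∑ x ∈ S, |c x| ≤ ∑ x ∈ S, K * jnorm x ^ (-b) := sum_le_sum hc
    _ = K * ∑ x ∈ S, jnorm x ^ (-b) := by rw [mul_sum]
    _ ≤ K * ∑' x : Site d, jnorm x ^ (-b) :=
        mul_le_mul_of_nonneg_left ((summable_jnorm_rpow_neg hb).sum_le_tsum _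
          (fun x _ => Real.rpow_nonneg (jnorm_pos x).le _)) hK

end LS24

end Literature.Barriers.CriticalPhenomena.SpreadOutIsing
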